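import Mathlib

/-!
# Stub `stub_intFour` of line `Sketch` for crux `SignCone.SignConeFarField`
(item stmt-RiemannHypothesis-16305, route route-RiemannHypothesis-SignCone)

The closed-form far-field integral of the minorant `1/sinh` on `[log 2, log 2001]`:

`log 3 − 1/1000 ≤ ∫_{log 2}^{log 2001} dx / sinh x`.

Proof: on `(0, ∞)` the function `P(x) = log(eˣ − 1) − log(eˣ + 1)` (`= log tanh(x/2)`) has derivative
`eˣ/(eˣ − 1) − eˣ/(eˣ + 1) = 2eˣ/(e^{2x} − 1) = 1/sinh x` (`Real.sinh_eq`), and `1/sinh` is continuous on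
`[log 2, log 2001]` (`sinh > 0` there), so by FTC-2 (`intervalIntegral.integral_eq_sub_of_hasDerivAt`)
the integral equals `P(log 2001) − P(log 2) = (log 2000 − log 2002) − (log 1 − log 3)`
`= log 3 − log(2002/2000) ≥ log 3 − (2002/2000 − 1) = log 3 − 1/1000` (`Real.log_le_sub_one_of_pos`).
The true value is `log 3 + log(1000/1001) = 1.0976…`.
-/

noncomputable section

-- the sub-problem path RiemannHypothesis/RiemannHypothesis duplicates a namespace (D-0017)
set_option linter.dupNamespace false

namespace Summit.RiemannHypothesis.RiemannHypothesis.Theorems.SignConeFarField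

/-- The primitive of `1/sinh`: for `x > 0`, `P(y) = log(eʸ − 1) − log(eʸ + 1)` has derivative
`1/sinh x` at `x`. -/
private theorem hasDerivAt_log_exp_sub_one_sub_log_exp_add_one {x : ℝ} (hx : 0 < x) :
    HasDerivAt (fun y => Real.log (Real.exp y - 1) - Real.log (Real.exp y + 1))
      (1 / Real.sinh x) x := by
  have h1 : 0 < Real.exp x - 1 := by
    have := Real.add_one_lt_exp hx.ne'
    linarith
  have h2 : 0 < Real.exp x + 1 := by positivity
  have hd : HasDerivAt (fun y => Real.log (Real.exp y - 1) - Real.log (Real.exp y + 1))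
      (Real.exp x / (Real.exp x - 1) - Real.exp x / (Real.exp x + 1)) x :=
    (((Real.hasDerivAt_exp x).sub_const 1).log h1.ne').sub
      (((Real.hasDerivAt_exp x).add_const 1).log h2.ne')
  convert hd using 1
  have hsinh : Real.sinh x ≠ 0 := (Real.sinh_pos_iff.2 hx).ne'
  rw [div_sub_div _ _ h1.ne' h2.ne', div_eq_div_iff hsinh (mul_ne_zero h1.ne' h2.ne'),
    Real.sinh_eq, Real.exp_neg]
  field_simp
  ring

/-- **Stub `stub_intFour` (far-field integral).** `∫_{log 2}^{log 2001} dx / sinh x ≥ log 3 − 1/1000`: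
the primitive `log(eˣ − 1) − log(eˣ + 1)` evaluates to `(log 2000 − log 2002) − (log 1 − log 3)`
`= log 3 − log(2002/2000) ≥ log 3 − 1/1000`. -/
theorem stub_intFour :
    Real.log 3 - 1 / 1000 ≤ ∫ x in Real.log 2..Real.log 2001, 1 / Real.sinh x := by
  have hab : Real.log 2 ≤ Real.log 2001 := Real.log_le_log (by norm_num) (by norm_num)
  have h2 : 0 < Real.log 2 := Real.log_pos (by norm_num)
  have hpos : ∀ x ∈ Set.uIcc (Real.log 2) (Real.log 2001), 0 < x := by
    intro x hx
    rw [Set.uIcc_of_le hab] at hx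
    exact lt_of_lt_of_le h2 hx.1
  have hderiv : ∀ x ∈ Set.uIcc (Real.log 2) (Real.log 2001),
      HasDerivAt (fun y => Real.log (Real.exp y - 1) - Real.log (Real.exp y + 1))
        (1 / Real.sinh x) x :=
    fun x hx => hasDerivAt_log_exp_sub_one_sub_log_exp_add_one (hpos x hx)
  have hcont : ContinuousOn (fun x => 1 / Real.sinh x) (Set.uIcc (Real.log 2) (Real.log 2001)) :=
    ContinuousOn.div₀ continuousOn_const Real.continuous_sinh.continuousOn
      fun x hx => (Real.sinh_pos_iff.2 (hpos x hx)).ne'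
  have hint : IntervalIntegrable (fun x => 1 / Real.sinh x) MeasureTheory.volume
      (Real.log 2) (Real.log 2001) :=
    hcont.intervalIntegrable
  rw [intervalIntegral.integral_eq_sub_of_hasDerivAt hderiv hint]
  rw [Real.exp_log (by norm_num : (0 : ℝ) < 2001), Real.exp_log (by norm_num : (0 : ℝ) < 2)]
  have e1 : (2001 : ℝ) - 1 = 2000 := by norm_num
  have e2 : (2001 : ℝ) + 1 = 2002 := by norm_num
  have e3 : (2 : ℝ) - 1 = 1 := by norm_num
  have e4 : (2 : ℝ) + 1 = 3 := by norm_num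
  rw [e1, e2, e3, e4, Real.log_one]
  have hlog := Real.log_le_sub_one_of_pos (show (0 : ℝ) < 2002 / 2000 by norm_num)
  rw [Real.log_div (by norm_num) (by norm_num)] at hlog
  norm_num at hlog
  linarith

end Summit.RiemannHypothesis.RiemannHypothesis.Theorems.SignConeFarField

end
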